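import Mathlib
import Summits.ValiantsHypothesis.ValiantsHypothesis.Theorems.BorderApolarityBorelFixedBorderApolarityTorusLimit

/-!
# `DetqpThesis` (stmt-ValiantsHypothesis-0315), line `four-dimensional-determinant` — stub B2t

Torus limits stay in the limit set, for a general weighted-homogeneous target.

Let `Y_f` be the set of degree-wise (`k ≤ m`) Kuratowski limits `J = lim_t Ann(P_t)` of
annihilators along sequences `P_t ∈ GL · det_m`, with `J_k ⌟ f = 0`, for a fixed target form `f`
in the `m²` matrix variables.  For an integer weight `μ` making `f` weighted homogeneous (all
monomials of `f` have `μ`-weight `ν₀`), the INITIAL SPAN `in_μ(J) = (in_μ(J_k))_k` — the limit of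
the torus translates `diag((s+2)^μ)⁻¹ J` as `s → ∞` — lies in `Y_f` again.

This is the mechanical generalisation of `bfba_torusLimit` (the case `f = ` padded permanent) to
an arbitrary weighted-homogeneous target; the target enters only through the torus-eigenvector
identity `diag(c^μ) · f = c^{ν₀} f` (`bfba_linSubst_torus_of_weight`) and the closedness of the
finite-dimensional plane `Ann_k(f)` (`exists_annSubmodule`).

Proof (diagonal argument).  Each translate `diag((s+2)^μ)⁻¹ J` is the limit of
`Ann(diag((s+2)^μ) · P_t)` (transport of annihilators); generators of `in_μ(J_k)` have explicit
approximants `H_s` in the translates (`tli_exists_approx`), which in turn have approximants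
`H_{s,t} ∈ Ann_k(diag((s+2)^μ) · P_t)`; choosing `t = τ(s)` with all of finitely many coefficient
errors `< 1/(s+1)` makes `H_{s,τ(s)} → ` generator, which gives (Li) along
`P'_s = diag((s+2)^μ) · P_{τ(s)}`; (Ls) follows from (Li) by the dimension count
`dim in_μ(J_k) = dim J_k = dim Ann_k` (`cellRetraction_coeff_ls_of_li`); and `in_μ(J_k) ⌟ f = 0`
because the translates kill `f` (torus eigenvector) and `Ann_k(f)` is closed.  Folklore.
-/

noncomputable section

set_option linter.dupNamespace false

namespace Summit.ValiantsHypothesis.ValiantsHypothesis.Theorems.DetQPDetqpThesis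

open Literature.Computability.AlgebraicComplexity MvPolynomial Filter
open scoped BigOperators Topology Matrix
open Summit.ValiantsHypothesis.ValiantsHypothesis.Theorems.BorderApolarityBorelFixedBorderApolarity
open Summit.ValiantsHypothesis.ValiantsHypothesis.Theorems.BorderApolarityToricFixedPoints
open Summit.ValiantsHypothesis.ValiantsHypothesis.Theorems.BorderApolarityFixedWitnessObstructionQP
  (stub_kuratowskiSubmodule stub_annSubmodule exists_annSubmodule mem_homogeneousSubmodule_of_tendsto)

/-- **Torus limits stay in `Y_f`** (general weighted-homogeneous target `f`).  If `J` is the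
degree-wise (`k ≤ m`) Kuratowski limit of the annihilators `Ann(P_t)` along `P_t ∈ GL · det_m`,
`J_k ⌟ f = 0` for `k ≤ m`, and every monomial of `f` has `μ`-weight `ν₀`, then the initial span
`in_μ(J)` is again such a limit (along the torus translates `diag((s+2)^μ) · P_{τ(s)}` for a
diagonal choice `τ`) and kills `f`.  See the module docstring; generalises `bfba_torusLimit`.
[folklore] -/
theorem stub_torusLimit_general {m : ℕ} (f : MvPolynomial (Fin m × Fin m) ℂ)
    (P : ℕ → MvPolynomial (Fin m × Fin m) ℂ)
    (hP : ∀ t, P t ∈ glOrbit (Fin m × Fin m) ℂ (detPoly (Fin m) ℂ))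
    (J : ℕ → Set (MvPolynomial (Fin m × Fin m) ℂ)) (hJ : IsBorderApolarLimit m P J)
    (hJf : ∀ k ≤ m, ∀ D ∈ J k, apolarAction D f = 0)
    (μ : Fin m × Fin m → ℤ) (ν₀ : ℤ)
    (hμ : ∀ d ∈ f.support, Finsupp.weight μ d = ν₀) :
    ∃ (P' : ℕ → MvPolynomial (Fin m × Fin m) ℂ) (J' : ℕ → Set (MvPolynomial (Fin m × Fin m) ℂ)),
      (∀ t, P' t ∈ glOrbit (Fin m × Fin m) ℂ (detPoly (Fin m) ℂ)) ∧ IsBorderApolarLimit m P' J' ∧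
      (∀ k ≤ m, ∀ D ∈ J' k, apolarAction D f = 0) ∧
      (∀ k, ∀ D, D ∈ J' k ↔ D ∈ Submodule.span ℂ {D' : MvPolynomial (Fin m × Fin m) ℂ |
          ∃ E ∈ J k, ∃ ν : ℤ, D' = weightedHomogeneousComponent μ ν E ∧
            ∀ ν' : ℤ, ν' < ν → weightedHomogeneousComponent μ ν' E = 0}) := by
  classical
  -- notation
  have hc0 : ∀ s : ℕ, ((s : ℂ) + 2) ≠ 0 := tli_natCast_add_two_ne_zero
  set T : ℕ → Matrix (Fin m × Fin m) (Fin m × Fin m) ℂ := fun s =>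
    Matrix.diagonal fun i => ((s : ℂ) + 2) ^ μ i with hT
  set Ti : ℕ → Matrix (Fin m × Fin m) (Fin m × Fin m) ℂ := fun s =>
    Matrix.diagonal fun i => ((s : ℂ) + 2) ^ (-μ i) with hTi
  have hTunit : ∀ s, IsUnit (T s).det := fun s => tli_isUnit_det_diagonal_zpow _ (hc0 s) μ
  have hTtrans : ∀ s, (T s)ᵀ = T s := fun s => Matrix.diagonal_transpose _
  have hTTi : ∀ s p, linSubst _ ℂ (T s) (linSubst _ ℂ (Ti s) p) = p := fun s p =>
    tli_linSubst_torus_linSubst_torus_neg _ (hc0 s) μ p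
  have hTiT : ∀ s p, linSubst _ ℂ (Ti s) (linSubst _ ℂ (T s) p) = p := fun s p =>
    tli_linSubst_torus_neg_linSubst_torus _ (hc0 s) μ p
  set ck : ℕ → ℕ := fun k => Nat.choose (m * m + k - 1) k - (Nat.choose m k) ^ 2 with hck
  haveI hfin : ∀ k, Module.Finite ℂ (homogeneousSubmodule (Fin m × Fin m) ℂ k) := fun k =>
    Module.Finite.iff_fg.2 (homogeneousSubmodule_fg _ ℂ k)
  -- the annihilator planes of a sequence in the orbit
  have hAnn : ∀ (Q : MvPolynomial (Fin m × Fin m) ℂ) (k : ℕ),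
      Q ∈ glOrbit (Fin m × Fin m) ℂ (detPoly (Fin m) ℂ) →
      ∃ A : Submodule ℂ (MvPolynomial (Fin m × Fin m) ℂ),
        (A : Set (MvPolynomial (Fin m × Fin m) ℂ)) = annihilatorOfDegree Q k ∧
        A ≤ homogeneousSubmodule (Fin m × Fin m) ℂ k ∧ Module.finrank ℂ A = ck k :=
    fun Q k hQ => stub_annSubmodule m k Q hQ
  -- `J k` as a submodule of dimension `ck k` (for `k ≤ m`)
  have hL : ∀ k, ∃ Lk : Submodule ℂ (MvPolynomial (Fin m × Fin m) ℂ),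
      Lk ≤ homogeneousSubmodule (Fin m × Fin m) ℂ k ∧
      (k ≤ m → (Lk : Set (MvPolynomial (Fin m × Fin m) ℂ)) = J k ∧ Module.finrank ℂ Lk = ck k) := by
    intro k
    by_cases hk : k ≤ m
    · have hA := fun t => hAnn (P t) k (hP t)
      choose A hAeq hAle hAd using hA
      obtain ⟨Lk, hLk, hle, hd⟩ := stub_kuratowskiSubmodule k (ck k) A (J k) hAle hAd
        (fun D hD => by
          obtain ⟨Ds, hDs, hlim⟩ := hJ.exists_tendsto hk hD
          exact ⟨Ds, fun t => by rw [← SetLike.mem_coe, hAeq]; exact hDs t, hlim⟩)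
        (fun D φ Ds hφ hDs hlim => hJ.mem_of_tendsto hk hφ
          (fun t => by rw [← hAeq, SetLike.mem_coe]; exact hDs t) hlim)
      exact ⟨Lk, hle, fun _ => ⟨hLk, hd⟩⟩
    · exact ⟨⊥, bot_le, fun h => absurd h hk⟩
  choose Lsub hLsub_le hLsub using hL
  have hmemL : ∀ k ≤ m, ∀ D, D ∈ Lsub k ↔ D ∈ J k := fun k hk D => by
    rw [← SetLike.mem_coe, (hLsub k hk).1]
  -- the initial spans
  set In : ℕ → Submodule ℂ (MvPolynomial (Fin m × Fin m) ℂ) := fun k =>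
    Submodule.span ℂ {D : MvPolynomial (Fin m × Fin m) ℂ | ∃ E ∈ Lsub k, ∃ ν : ℤ,
      D = weightedHomogeneousComponent μ ν E ∧
        ∀ ν' : ℤ, ν' < ν → weightedHomogeneousComponent μ ν' E = 0} with hIn
  have hIn_le : ∀ k, In k ≤ homogeneousSubmodule (Fin m × Fin m) ℂ k := fun k =>
    bfba_initSpan_le_hom μ k (Lsub k) (hLsub_le k)
  have hIn_d : ∀ k ≤ m, Module.finrank ℂ (In k) = ck k := fun k hk => by
    rw [hIn, bfba_finrank_initSpan μ k (Lsub k) (hLsub_le k), (hLsub k hk).2]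
  have hIn_J : ∀ k ≤ m, ∀ D, D ∈ In k ↔ D ∈ Submodule.span ℂ {D' : MvPolynomial (Fin m × Fin m) ℂ |
      ∃ E ∈ J k, ∃ ν : ℤ, D' = weightedHomogeneousComponent μ ν E ∧
        ∀ ν' : ℤ, ν' < ν → weightedHomogeneousComponent μ ν' E = 0} := by
    intro k hk D
    have hset : {D : MvPolynomial (Fin m × Fin m) ℂ | ∃ E ∈ Lsub k, ∃ ν : ℤ,
        D = weightedHomogeneousComponent μ ν E ∧
          ∀ ν' : ℤ, ν' < ν → weightedHomogeneousComponent μ ν' E = 0} =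
        {D' : MvPolynomial (Fin m × Fin m) ℂ | ∃ E ∈ J k, ∃ ν : ℤ,
          D' = weightedHomogeneousComponent μ ν E ∧
            ∀ ν' : ℤ, ν' < ν → weightedHomogeneousComponent μ ν' E = 0} := by
      ext D'
      simp only [Set.mem_setOf_eq, hmemL k hk]
    simp only [hIn]
    rw [hset]
  -- finite generating families of the initial spans
  have hgen : ∀ k, ∃ (nk : ℕ) (g : ℕ → MvPolynomial (Fin m × Fin m) ℂ), (∀ i, g i ∈ In k) ∧
      ∀ D ∈ In k, ∃ a : ℕ → ℂ, D = ∑ i ∈ Finset.range nk, a i • g i := by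
    intro k
    haveI : Module.Finite ℂ (In k) := Submodule.finiteDimensional_of_le (hIn_le k)
    obtain ⟨nk, s, hs⟩ := Module.Finite.exists_fin (R := ℂ) (M := In k)
    refine ⟨nk, fun i => if h : i < nk then (s ⟨i, h⟩ : MvPolynomial (Fin m × Fin m) ℂ) else 0,
      fun i => ?_, fun D hD => ?_⟩
    · dsimp only
      split_ifs with h
      · exact (s ⟨i, h⟩).2
      · exact Submodule.zero_mem _
    · have hD' : (⟨D, hD⟩ : In k) ∈ Submodule.span ℂ (Set.range s) := by rw [hs]; trivial
      obtain ⟨c, hc⟩ := (Submodule.mem_span_range_iff_exists_fun ℂ).1 hD'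
      refine ⟨fun i => if h : i < nk then c ⟨i, h⟩ else 0, ?_⟩
      have h1 := congrArg Subtype.val hc
      simp only [Submodule.coe_sum, Submodule.coe_smul] at h1
      rw [← h1, Finset.sum_range (fun i => (if h : i < nk then c ⟨i, h⟩ else 0) •
        (if h : i < nk then (s ⟨i, h⟩ : MvPolynomial (Fin m × Fin m) ℂ) else 0))]
      refine Finset.sum_congr rfl fun i _ => ?_
      simp only [i.isLt, dif_pos]
  choose nk g hgIn hgspan using hgen
  -- approximants of the generators in the torus translates (`tli_exists_approx`)
  have hH : ∀ k i, ∃ H : ℕ → MvPolynomial (Fin m × Fin m) ℂ,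
      (∀ s, (H s).IsHomogeneous k ∧ linSubst _ ℂ (T s) (H s) ∈ Lsub k) ∧
      Tendsto (fun s => coeffVec (H s)) atTop (𝓝 (coeffVec (g k i))) :=
    fun k i => tli_exists_approx μ k (Lsub k) (hLsub_le k) tendsto_id (hgIn k i)
  choose H hH hHlim using hH
  -- approximants of `T s · H k i s ∈ J k` along `Ann(P t)` (Li)
  have hE : ∀ k i s, ∃ Es : ℕ → MvPolynomial (Fin m × Fin m) ℂ, k ≤ m →
      ((∀ t, Es t ∈ annihilatorOfDegree (P t) k) ∧
        Tendsto (fun t => coeffVec (Es t)) atTop (𝓝 (coeffVec (linSubst _ ℂ (T s) (H k i s))))) := by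
    intro k i s
    by_cases hk : k ≤ m
    · obtain ⟨Es, hEs, hlim⟩ := hJ.exists_tendsto hk ((hmemL k hk _).1 (hH k i s).2)
      exact ⟨Es, fun _ => ⟨hEs, hlim⟩⟩
    · exact ⟨fun _ => 0, fun h => absurd h hk⟩
  choose Es hEs using hE
  -- pulled back: `Ti s · Es ∈ Ann(T s · P t)` and `→ H k i s` as `t → ∞`
  have hEs' : ∀ k ≤ m, ∀ i s,
      (∀ t, linSubst _ ℂ (Ti s) (Es k i s t) ∈ annihilatorOfDegree (linSubst _ ℂ (T s) (P t)) k) ∧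
      Tendsto (fun t => coeffVec (linSubst _ ℂ (Ti s) (Es k i s t))) atTop
        (𝓝 (coeffVec (H k i s))) := by
    intro k hk i s
    obtain ⟨h1, h2⟩ := hEs k i s hk
    refine ⟨fun t => ?_, ?_⟩
    · rw [bfba_mem_annihilatorOfDegree_linSubst_iff _ (hTunit s), hTtrans, hTTi]
      exact h1 t
    · have h3 := tli_tendsto_coeffVec_linSubst (Ti s) (fun t => (h1 t).1)
        (linSubst_isHomogeneous _ (hH k i s).1) h2
      simpa only [hTiT] using h3
  -- the generic torus translates `P' s t = T s · P t` lie in the orbit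
  have hP' : ∀ s t, linSubst _ ℂ (T s) (P t) ∈ glOrbit (Fin m × Fin m) ℂ (detPoly (Fin m) ℂ) :=
    fun s t => bfba_linSubst_mem_glOrbit (hP t) _ (hTunit s)
  -- the finitely many indices and exponents to control, and the diagonal choice `τ`
  set Rmax : ℕ := (Finset.range (m + 1)).sup nk with hRmax
  have hnk : ∀ k ≤ m, nk k ≤ Rmax := fun k hk =>
    Finset.le_sup (f := nk) (Finset.mem_range.2 (Nat.lt_succ_of_le hk))
  have hanti : ∀ (k : ℕ) (e : Fin m × Fin m →₀ ℕ),
      e ∈ (Finset.univ : Finset (Fin m × Fin m)).finsuppAntidiag k ↔ e.degree = k := fun k e => by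
    simp [Finset.mem_finsuppAntidiag, Finsupp.degree_eq_sum]
  set Eall : Finset (Fin m × Fin m →₀ ℕ) := (Finset.range (m + 1)).biUnion
    (fun k => (Finset.univ : Finset (Fin m × Fin m)).finsuppAntidiag k) with hEall
  have hEall_mem : ∀ e : Fin m × Fin m →₀ ℕ, e.degree ≤ m → e ∈ Eall := fun e he =>
    Finset.mem_biUnion.2 ⟨e.degree, Finset.mem_range.2 (Nat.lt_succ_of_le he), (hanti _ e).2 rfl⟩
  set I : Finset (ℕ × ℕ × (Fin m × Fin m →₀ ℕ)) :=
    (Finset.range (m + 1)) ×ˢ ((Finset.range Rmax) ×ˢ Eall) with hI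
  have hImem : ∀ k ≤ m, ∀ i < Rmax, ∀ e : Fin m × Fin m →₀ ℕ, e.degree ≤ m → (k, i, e) ∈ I :=
    fun k hk i hi e he => Finset.mem_product.2 ⟨Finset.mem_range.2 (Nat.lt_succ_of_le hk),
      Finset.mem_product.2 ⟨Finset.mem_range.2 hi, hEall_mem e he⟩⟩
  have hτex : ∀ s : ℕ, ∃ t : ℕ, ∀ x ∈ I,
      dist (coeff x.2.2 (linSubst _ ℂ (Ti s) (Es x.1 x.2.1 s t))) (coeff x.2.2 (H x.1 x.2.1 s)) <
        1 / ((s : ℝ) + 1) := by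
    intro s
    have hev : ∀ᶠ t in atTop, ∀ x ∈ I,
        dist (coeff x.2.2 (linSubst _ ℂ (Ti s) (Es x.1 x.2.1 s t))) (coeff x.2.2 (H x.1 x.2.1 s)) <
          1 / ((s : ℝ) + 1) := by
      refine (Filter.eventually_all_finset I).2 fun x hx => ?_
      have hk : x.1 ≤ m := Nat.lt_succ_iff.1 (Finset.mem_range.1 (Finset.mem_product.1 hx).1)
      have h1 := (hEs' x.1 hk x.2.1 s).2
      have h2 : Tendsto (fun t => coeff x.2.2 (linSubst _ ℂ (Ti s) (Es x.1 x.2.1 s t))) atTop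
          (𝓝 (coeff x.2.2 (H x.1 x.2.1 s))) := by
        have h3 := ((continuous_apply x.2.2).tendsto _).comp h1
        simpa only [Function.comp_def, coeffVec_apply] using h3
      exact Metric.tendsto_nhds.1 h2 _ (by positivity)
    exact hev.exists
  choose τ hτ using hτex
  -- the controlled approximants converge to the generators
  have hZ : ∀ k ≤ m, ∀ i < Rmax,
      Tendsto (fun s => coeffVec (linSubst _ ℂ (Ti s) (Es k i s (τ s)))) atTop (𝓝 (coeffVec (g k i))) := by
    intro k hk i hi
    rw [tendsto_pi_nhds]
    intro e
    by_cases he : e.degree = k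
    · have hd : ∀ s, dist (coeff e (linSubst _ ℂ (Ti s) (Es k i s (τ s)))) (coeff e (H k i s)) <
          1 / ((s : ℝ) + 1) := fun s => hτ s (k, i, e) (hImem k hk i hi e (he.le.trans hk))
      have hHe : Tendsto (fun s => coeff e (H k i s)) atTop (𝓝 (coeff e (g k i))) := by
        have h3 := ((continuous_apply e).tendsto _).comp (hHlim k i)
        simpa only [Function.comp_def, coeffVec_apply] using h3
      have h0 : Tendsto (fun s => dist (coeff e (H k i s)) (coeff e (linSubst _ ℂ (Ti s) (Es k i s (τ s)))))
          atTop (𝓝 0) := by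
        refine squeeze_zero (fun s => dist_nonneg) (fun s => ?_) tendsto_one_div_add_atTop_nhds_zero_nat
        rw [dist_comm]
        exact (hd s).le
      have h4 := hHe.congr_dist h0
      simpa only [coeffVec_apply] using h4
    · have h1 : ∀ s, coeffVec (linSubst _ ℂ (Ti s) (Es k i s (τ s))) e = 0 := fun s =>
        ((hEs' k hk i s).1 (τ s)).1.coeff_eq_zero he
      have h2 : coeffVec (g k i) e = 0 :=
        ((mem_homogeneousSubmodule k _).1 (hIn_le k (hgIn k i))).coeff_eq_zero he
      simp only [h1, h2]
      exact tendsto_const_nhds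
  -- (Li) for the initial spans along `P' s = T s · P (τ s)`
  have hLiIn : ∀ k ≤ m, ∀ D ∈ In k, ∃ Ds : ℕ → MvPolynomial (Fin m × Fin m) ℂ,
      (∀ s, Ds s ∈ annihilatorOfDegree (linSubst _ ℂ (T s) (P (τ s))) k) ∧
      Tendsto (fun s => coeffVec (Ds s)) atTop (𝓝 (coeffVec D)) := by
    intro k hk D hDIn
    obtain ⟨a, ha⟩ := hgspan k D hDIn
    refine ⟨fun s => ∑ i ∈ Finset.range (nk k), a i • linSubst _ ℂ (Ti s) (Es k i s (τ s)),
      fun s => ?_, ?_⟩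
    · obtain ⟨A, hAeq, -, -⟩ := hAnn _ k (hP' s (τ s))
      have hmem : (∑ i ∈ Finset.range (nk k), a i • linSubst _ ℂ (Ti s) (Es k i s (τ s))) ∈ A :=
        A.sum_mem fun i _ => A.smul_mem _ (by
          rw [← SetLike.mem_coe, hAeq]; exact (hEs' k hk i s).1 (τ s))
      rw [← SetLike.mem_coe, hAeq] at hmem
      exact hmem
    · rw [ha, bfba_coeffVec_sum_smul]
      simp only [bfba_coeffVec_sum_smul]
      exact tendsto_finsetSum _ fun i hi =>
        (hZ k hk i (lt_of_lt_of_le (Finset.mem_range.1 hi) (hnk k hk))).const_smul (a i)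
  refine ⟨fun s => linSubst _ ℂ (T s) (P (τ s)),
    fun k => {D | D ∈ Submodule.span ℂ {D' : MvPolynomial (Fin m × Fin m) ℂ |
      ∃ E ∈ J k, ∃ ν : ℤ, D' = weightedHomogeneousComponent μ ν E ∧
        ∀ ν' : ℤ, ν' < ν → weightedHomogeneousComponent μ ν' E = 0}},
    fun s => hP' s (τ s), ⟨?_, ?_⟩, ?_, fun k D => Iff.rfl⟩
  · -- (Li)
    intro k hk D hD
    obtain ⟨Ds, hDs, hlim⟩ := hLiIn k hk D ((hIn_J k hk D).2 hD)
    exact ⟨Ds, hDs, hlim⟩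
  · -- (Ls), by the dimension count
    intro k hk D φ Ds hφ hDs hlim
    have hA' := fun s => hAnn (linSubst _ ℂ (T s) (P (τ s))) k (hP' s (τ s))
    choose A' hA'eq hA'le hA'd using hA'
    have h := cellRetraction_coeff_ls_of_li k (ck k) A' (In k) hA'le (hIn_le k) hA'd (hIn_d k hk)
      (fun D' hD' => by
        obtain ⟨Ds', hDs', hlim'⟩ := hLiIn k hk D' hD'
        exact ⟨Ds', fun s => by rw [← SetLike.mem_coe, hA'eq]; exact hDs' s, hlim'⟩)
      D φ Ds hφ (fun t => by rw [← SetLike.mem_coe, hA'eq]; exact hDs t) hlim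
    exact (hIn_J k hk D).1 h
  · -- the initial spans kill `f`
    intro k hk D hD
    have hDIn : D ∈ In k := (hIn_J k hk D).2 hD
    obtain ⟨Hs, hHs, hlim⟩ := tli_exists_approx μ k (Lsub k) (hLsub_le k) tendsto_id hDIn
    have hkill : ∀ s, apolarAction (Hs s) (f) = 0 := by
      intro s
      have h1 : apolarAction (linSubst _ ℂ (T s) (Hs s)) (f) = 0 :=
        hJf k hk _ ((hmemL k hk _).1 (hHs s).2)
      have h2 : apolarAction (Hs s) (linSubst _ ℂ (T s) (f)) = 0 := by
        rw [apolarAction_linSubst_eq_zero_iff _ (hTunit s), hTtrans]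
        exact h1
      have h3 : linSubst _ ℂ (T s) (f) = (((s : ℂ) + 2) ^ ν₀) • f :=
        bfba_linSubst_torus_of_weight μ ν₀ hμ _ (hc0 s)
      rw [h3, apolarAction_smul_right] at h2
      exact (smul_eq_zero.1 h2).resolve_left (zpow_ne_zero _ (hc0 s))
    obtain ⟨App, hAppeq, hApple, -⟩ := exists_annSubmodule k (f)
    haveI : FiniteDimensional ℂ App := Submodule.finiteDimensional_of_le hApple
    have hmem : D ∈ App :=
      ca_mem_of_tendsto_coeffVec App
        (fun s => by rw [← SetLike.mem_coe, hAppeq]; exact ⟨(hHs s).1, hkill s⟩) hlim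
    rw [← SetLike.mem_coe, hAppeq] at hmem
    exact hmem.2


end Summit.ValiantsHypothesis.ValiantsHypothesis.Theorems.DetQPDetqpThesis

end
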